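import Mathlib.Topology.Connected.LocallyPathConnected
import Literature.Topology.PlaneTopology.Janiszewski
import Literature.Topology.PlaneTopology.OpenSetArcs
import Literature.Probability.Percolation.LatticePathArcs
import Literature.Probability.Percolation.LatticeShadowOfPath
import Literature.Probability.Percolation.ScaledLatticeWalks
import Literature.Probability.Percolation.LatticeTraceBlocking
import Literature.Probability.Percolation.BoxCrossingProofs
import HarnessLib

/-!
# Plane topology for the staircase cross-cuts, I: arc removal, lattice shadows, mesh traces

Helper module for the registered stubs `stub_quadTransfer_stairArcThrough` /
`stub_quadTransfer_noIdleRelStairCuts` of line `hitting-tournament` of crux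
`CardySelfRefinement.LagHandOff` (stmt-CriticalPhenomena-10268), method step (d) of
`stub_quadTransfer` (the target family `stairCuts D` of
`Theorems/CardySelfRefinementLagHandOffStairCuts.lean`).  Deterministic plane topology / lattice
combinatorics:

* `isPreconnected_diff_of_isPreconnected_compl`, `isPreconnected_diff_arc` — **a compact set with
  connected complement (e.g. a simple arc, `IsSimpleArc.isConnected_compl`) does not disconnect an
  open connected set containing it** (Janiszewski's theorem with the second compact set
  `B̄(0,R) ∖ (U ∩ B(0,R))`);
* `stub_quadTransfer_latticeShadow` (registered stub) — **a path between two lattice points is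
  shadowed by a lattice walk with the same endpoints** whose mesh trace stays within `4δ` of the path (the tree's
  `exists_walk_near_path` plus two corner steps `exists_walk_corner`);
* `meshTrace_runWalk_subset` — straight runs of the refined lattice have straight traces;
* `exists_finset_meshTrace` — the mesh trace of a lattice walk at a rational mesh is a finite union
  of axis-parallel segments with rational endpoints.

Continued in `…StairCutsLegs.lean` (legs) and `…StairCutsArc.lean` (the staircase arc through a
lattice edge).
-/

noncomputable section

open Set Metric
open Literature.Topology.PlaneTopology Literature.Probability.LatticeModels
open Literature.Probability.Percolation

namespace Summit.CriticalPhenomena.CardyFormulaZ2.Cruxes.LagHandOff.HittingTournament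

/-! ### Removing a compact set with connected complement from an open connected set -/

/-- **A compact set with (pre)connected complement does not disconnect an open preconnected set
containing it.**  Janiszewski: two points of `U ∖ A` are separated neither by `A` nor by the
compact set `B = B̄(0,R) ∖ (U ∩ B(0,R))` (`R` large), `A ∩ B = ∅`; the component of
`ℂ ∖ (A ∪ B)` containing them misses the sphere `|z| = R ⊆ B`, hence lies in `U ∩ B(0,R) ∖ A`. -/
theorem isPreconnected_diff_of_isPreconnected_compl {U A : Set ℂ} (hU : IsOpen U)
    (hUc : IsPreconnected U) (hA : IsCompact A) (hAc : IsPreconnected Aᶜ) (hAU : A ⊆ U) :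
    IsPreconnected (U \ A) := by
  refine isPreconnected_of_forall_pair fun x hx y hy => ?_
  -- a path from `x` to `y` inside `U`
  have hUpc : IsPathConnected U := (hU.isConnected_iff_isPathConnected).1 ⟨⟨x, hx.1⟩, hUc⟩
  obtain ⟨p, hp⟩ := hUpc.joinedIn x hx.1 y hy.1
  have hRc : IsCompact (range p) := isCompact_range p.continuous
  obtain ⟨R, hR⟩ := (hRc.union hA).isBounded.subset_ball 0
  -- the second compact set
  set B : Set ℂ := closedBall (0 : ℂ) R ∩ (U ∩ ball 0 R)ᶜ with hB
  have hBc : IsCompact B := (isCompact_closedBall 0 R).inter_right (hU.inter isOpen_ball).isClosed_compl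
  have hAB : IsPreconnected (A ∩ B) := by
    have : A ∩ B = ∅ := Set.eq_empty_iff_forall_notMem.2
      fun z ⟨hzA, hzB⟩ => hzB.2 ⟨hAU hzA, hR (Or.inr hzA)⟩
    rw [this]
    exact isPreconnected_empty
  have hyA : y ∈ connectedComponentIn Aᶜ x :=
    hAc.subset_connectedComponentIn (x := x) hx.2 subset_rfl hy.2
  have hrange : range p ⊆ Bᶜ := fun z hz hzB => hzB.2 ⟨by obtain ⟨t, rfl⟩ := hz; exact hp t,
    hR (Or.inl hz)⟩
  have hpre : IsPreconnected (range p) :=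
    (isPreconnected_range (f := p) p.continuous)
  have hyB : y ∈ connectedComponentIn Bᶜ x := by
    have hx' : x ∈ range p := ⟨0, p.source⟩
    have hy' : y ∈ range p := ⟨1, p.target⟩
    exact hpre.subset_connectedComponentIn hx' hrange hy'
  have hj := janiszewski hA hBc hAB hyA hyB
  set C : Set ℂ := connectedComponentIn (A ∪ B)ᶜ x with hC
  have hCpre : IsPreconnected C := isPreconnected_connectedComponentIn
  have hCsub : C ⊆ (A ∪ B)ᶜ := connectedComponentIn_subset _ _
  have hxR : x ∈ ball (0 : ℂ) R := hR (Or.inl ⟨0, p.source⟩)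
  have hxC : x ∈ C := mem_connectedComponentIn fun h => h.elim hx.2 fun hxB => hxB.2 ⟨hx.1, hxR⟩
  -- `C` stays inside the ball `B(0, R)`
  have hCball : C ⊆ ball 0 R := by
    refine hCpre.subset_left_of_subset_union (v := (closedBall (0 : ℂ) R)ᶜ) isOpen_ball
      isClosed_closedBall.isOpen_compl ?_ ?_ ⟨x, hxC, hxR⟩
    · exact Set.disjoint_left.2 fun z hz hz' => hz' (ball_subset_closedBall hz)
    · intro z hz
      by_cases hzb : z ∈ ball (0 : ℂ) R
      · exact Or.inl hzb
      · refine Or.inr fun hzcb => hCsub hz (Or.inr ⟨hzcb, fun h => hzb h.2⟩)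
  refine ⟨C, fun z hz => ⟨?_, fun hzA => hCsub hz (Or.inl hzA)⟩, hxC, hj, hCpre⟩
  have hzb := hCball hz
  by_contra hzU
  exact hCsub hz (Or.inr ⟨ball_subset_closedBall hzb, fun h => hzU h.1⟩)

/-- A simple arc inside an open preconnected set does not disconnect it. -/
theorem isPreconnected_diff_arc {U L : Set ℂ} {a b : ℂ} (hU : IsOpen U) (hUc : IsPreconnected U)
    (hL : IsSimpleArc L a b) (hLU : L ⊆ U) : IsPreconnected (U \ L) :=
  isPreconnected_diff_of_isPreconnected_compl hU hUc hL.isCompact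
    hL.isConnected_compl.isPreconnected hLU

/-! ### Lattice walks: corner steps, shadows with prescribed endpoints, straight runs -/

/-- **Corner steps.** A corner `x` of the mesh square with lower-left corner `u` is joined to `u`
by a lattice walk (of length `≤ 2`) through corners of that square. -/
theorem exists_walk_corner (u x : Site 2) (h0 : x 0 = u 0 ∨ x 0 = u 0 + 1)
    (h1 : x 1 = u 1 ∨ x 1 = u 1 + 1) :
    ∃ p : (zdGraph 2).Walk x u, ∀ v ∈ p.support,
      (v 0 = u 0 ∨ v 0 = u 0 + 1) ∧ (v 1 = u 1 ∨ v 1 = u 1 + 1) := by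
  -- the intermediate corner `m = (x 0, u 1)`
  set m : Site 2 := ![x 0, u 1] with hm
  have hm0 : m 0 = x 0 := by simp [hm]
  have hm1 : m 1 = u 1 := by simp [hm]
  -- `x → m`
  obtain ⟨p₁, hp₁⟩ : ∃ p : (zdGraph 2).Walk x m, ∀ v ∈ p.support, v = x ∨ v = m := by
    rcases h1 with h | h
    · have hxm : x = m := Site.eq_iff_two.2 ⟨hm0.symm, by rw [hm1, h]⟩
      exact ⟨SimpleGraph.Walk.nil.copy rfl hxm, fun v hv => by simp at hv; exact Or.inl hv⟩
    · have hxm : x = m + Pi.single 1 1 := Site.eq_iff_two.2 ⟨by simp [hm0], by simp [hm1, h]⟩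
      have hadj : (zdGraph 2).Adj x m := by rw [hxm]; exact ((zdGraph_adj_iff _ _).2 ⟨1, Or.inl rfl⟩).symm
      exact ⟨SimpleGraph.Walk.cons hadj SimpleGraph.Walk.nil, fun v hv => by simpa using hv⟩
  -- `m → u`
  obtain ⟨p₂, hp₂⟩ : ∃ p : (zdGraph 2).Walk m u, ∀ v ∈ p.support, v = m ∨ v = u := by
    rcases h0 with h | h
    · have hmu : m = u := Site.eq_iff_two.2 ⟨by rw [hm0, h], hm1⟩
      exact ⟨SimpleGraph.Walk.nil.copy rfl hmu, fun v hv => by simp at hv; exact Or.inl hv⟩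
    · have hmu : m = u + Pi.single 0 1 := Site.eq_iff_two.2 ⟨by simp [hm0, h], by simp [hm1]⟩
      have hadj : (zdGraph 2).Adj m u := by rw [hmu]; exact ((zdGraph_adj_iff _ _).2 ⟨0, Or.inl rfl⟩).symm
      exact ⟨SimpleGraph.Walk.cons hadj SimpleGraph.Walk.nil, fun v hv => by simpa using hv⟩
  refine ⟨p₁.append p₂, fun v hv => ?_⟩
  rw [SimpleGraph.Walk.mem_support_append_iff] at hv
  have hv' : v = x ∨ v = m ∨ v = u := by
    rcases hv with hv | hv
    · rcases hp₁ v hv with h | h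
      · exact Or.inl h
      · exact Or.inr (Or.inl h)
    · exact Or.inr (hp₂ v hv)
  rcases hv' with rfl | rfl | rfl
  · exact ⟨h0, h1⟩
  · exact ⟨by rw [hm0]; exact h0, Or.inl hm1⟩
  · exact ⟨Or.inl rfl, Or.inl rfl⟩

/-- Two corners of one mesh square are at distance `≤ 2δ`. -/
theorem dist_meshPoint_corner_le {δ : ℝ} (hδ : 0 ≤ δ) {u v x : Site 2}
    (hv : (v 0 = u 0 ∨ v 0 = u 0 + 1) ∧ (v 1 = u 1 ∨ v 1 = u 1 + 1))
    (hx : (x 0 = u 0 ∨ x 0 = u 0 + 1) ∧ (x 1 = u 1 ∨ x 1 = u 1 + 1)) :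
    dist (meshPoint δ v) (meshPoint δ x) ≤ 2 * δ := by
  have h0 : |((v 0 : ℤ) : ℝ) - x 0| ≤ 1 := by
    have : |v 0 - x 0| ≤ 1 := by
      rcases hv.1 with h | h <;> rcases hx.1 with h' | h' <;> rw [h, h', abs_le] <;> omega
    exact_mod_cast this
  have h1 : |((v 1 : ℤ) : ℝ) - x 1| ≤ 1 := by
    have : |v 1 - x 1| ≤ 1 := by
      rcases hv.2 with h | h <;> rcases hx.2 with h' | h' <;> rw [h, h', abs_le] <;> omega
    exact_mod_cast this
  rw [Complex.dist_eq]
  refine (Complex.norm_le_abs_re_add_abs_im _).trans ?_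
  have hre : (meshPoint δ v - meshPoint δ x).re = δ * (v 0 - x 0) := by
    simp only [Complex.sub_re, meshPoint_re]; ring
  have him : (meshPoint δ v - meshPoint δ x).im = δ * (v 1 - x 1) := by
    simp only [Complex.sub_im, meshPoint_im]; ring
  rw [hre, him, abs_mul, abs_mul, abs_of_nonneg hδ]
  nlinarith

/-- The mesh trace of an appended walk is the union of the mesh traces. -/
theorem meshTrace_append (δ : ℝ) {u v w : Site 2} (p : (zdGraph 2).Walk u v)
    (q : (zdGraph 2).Walk v w) : meshTrace δ (p.append q) = meshTrace δ p ∪ meshTrace δ q := by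
  ext z
  simp only [mem_meshTrace_iff, SimpleGraph.Walk.edges_append, List.mem_append, mem_union]
  constructor
  · rintro ⟨e, he | he, hz⟩
    · exact Or.inl ⟨e, he, hz⟩
    · exact Or.inr ⟨e, he, hz⟩
  · rintro (⟨e, he, hz⟩ | ⟨e, he, hz⟩)
    · exact ⟨e, Or.inl he, hz⟩
    · exact ⟨e, Or.inr he, hz⟩

/-- The mesh trace does not see `SimpleGraph.Walk.copy`. -/
theorem meshTrace_copy (δ : ℝ) {u v u' v' : Site 2} (p : (zdGraph 2).Walk u v) (hu : u = u')
    (hv : v = v') : meshTrace δ (p.copy hu hv) = meshTrace δ p := by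
  subst hu hv
  rfl

/-- Loop erasure shrinks the mesh trace. -/
theorem meshTrace_bypass_subset (δ : ℝ) {u v : Site 2} (p : (zdGraph 2).Walk u v) :
    meshTrace δ p.bypass ⊆ meshTrace δ p := fun z hz => by
  obtain ⟨e, he, hz⟩ := mem_meshTrace_iff.1 hz
  exact mem_meshTrace_iff.2 ⟨e, p.edges_bypass_subset_edges he, hz⟩

/-- **Shadow with prescribed endpoints.** A path between two lattice points of mesh `δ > 0` is
shadowed by a lattice walk WITH THE SAME ENDPOINTS whose mesh trace stays within `4δ` of the
path: the tree's shadow `exists_walk_near_path` (sites within `2δ`) completed by corner steps at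
the two ends. -/
theorem stub_quadTransfer_latticeShadow :
    ∀ (δ : ℝ), 0 < δ → ∀ (x y : Site 2) (γ : Path (meshPoint δ x) (meshPoint δ y)),
      ∃ π : (zdGraph 2).Walk x y, ∀ z ∈ meshTrace δ π, ∃ t : unitInterval, dist z (γ t) < 4 * δ := by
  intro δ hδ x y γ
  have hγe : ContinuousOn γ.extend (Icc 0 1) := γ.continuous_extend.continuousOn
  obtain ⟨u, w, π₀, -, -, hw, hu, hπ₀⟩ := exists_walk_near_path hδ hγe
  rw [γ.extend_zero] at hu
  rw [γ.extend_one] at hw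
  obtain ⟨a, b, ha, hb, hx0, hx1⟩ := exists_eq_add_of_meshPoint_mem_face hδ hu
  obtain ⟨a', b', ha', hb', hy0, hy1⟩ := exists_eq_add_of_meshPoint_mem_face hδ hw
  have hxc : (x 0 = u 0 ∨ x 0 = u 0 + 1) ∧ (x 1 = u 1 ∨ x 1 = u 1 + 1) := by
    constructor
    · rcases ha with rfl | rfl
      · left; omega
      · right; omega
    · rcases hb with rfl | rfl
      · left; omega
      · right; omega
  have hyc : (y 0 = w 0 ∨ y 0 = w 0 + 1) ∧ (y 1 = w 1 ∨ y 1 = w 1 + 1) := by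
    constructor
    · rcases ha' with rfl | rfl
      · left; omega
      · right; omega
    · rcases hb' with rfl | rfl
      · left; omega
      · right; omega
  obtain ⟨p₁, hp₁⟩ := exists_walk_corner u x hxc.1 hxc.2
  obtain ⟨p₂, hp₂⟩ := exists_walk_corner w y hyc.1 hyc.2
  refine ⟨p₁.append (π₀.append p₂.reverse), fun z hz => ?_⟩
  obtain ⟨v, hv, hzv⟩ := exists_dist_meshPoint_le_of_mem_meshTrace hz
  rw [abs_of_pos hδ] at hzv
  rw [SimpleGraph.Walk.mem_support_append_iff, SimpleGraph.Walk.mem_support_append_iff, SimpleGraph.Walk.support_reverse,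
    List.mem_reverse] at hv
  rcases hv with hv | hv | hv
  · -- a corner of the square of `u`: close to `γ 0 = δ x`
    refine ⟨0, ?_⟩
    rw [γ.source]
    have := dist_meshPoint_corner_le hδ.le (hp₁ v hv) hxc
    linarith [dist_triangle z (meshPoint δ v) (meshPoint δ x)]
  · obtain ⟨t, ht, hvt⟩ := hπ₀ v hv
    refine ⟨⟨t, ht⟩, ?_⟩
    rw [γ.extend_apply ht] at hvt
    linarith [dist_triangle z (meshPoint δ v) (γ ⟨t, ht⟩)]
  · refine ⟨1, ?_⟩
    rw [γ.target]
    have := dist_meshPoint_corner_le hδ.le (hp₂ v hv) hyc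
    linarith [dist_triangle z (meshPoint δ v) (meshPoint δ y)]

/-- **Straight runs have straight traces.** At mesh `δ / M`, the straight run of `M` unit steps
subdividing the coarse step `x → y` has its mesh trace on the closed coarse mesh edge
`[δ x, δ y]`. -/
theorem meshTrace_runWalk_subset {δ : ℝ} {M : ℕ} (hM : M ≠ 0) {x y : Site 2}
    (hxy : (zdGraph 2).Adj x y) :
    meshTrace (δ / M) (runWalk (y - x) (zdGraph_adj_zero_sub hxy) ((M : ℤ) • x) M) ⊆
      segment ℝ (meshPoint δ x) (meshPoint δ y) := by
  intro z hz
  obtain ⟨e, he, hz⟩ := mem_meshTrace_iff.1 hz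
  obtain ⟨dt, hdt, rfl⟩ := List.mem_map.1 he
  obtain ⟨j, hj, h1, h2⟩ := exists_of_mem_darts_runWalk hdt
  have hedge : dt.edge = s(dt.fst, dt.snd) := rfl
  rw [hedge, ← segment_meshPoint_eq_image, h1, h2] at hz
  have ha := meshPoint_subdivision_mem_segment (δ := δ) hM x y hj.le
  have hb := meshPoint_subdivision_mem_segment (δ := δ) hM x y (Nat.succ_le_of_lt hj)
  push_cast at hb
  exact (convex_segment _ _).segment_subset ha hb hz

/-! ### Rational description of mesh traces -/

/-- **The mesh trace of a lattice walk at a rational mesh is a finite union of axis-parallel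
segments with rational endpoints.** -/
theorem exists_finset_meshTrace (δ : ℚ) {u v : Site 2} (π : (zdGraph 2).Walk u v) :
    ∃ S : Finset ((ℚ × ℚ) × (ℚ × ℚ)), (∀ s ∈ S, s.1.1 = s.2.1 ∨ s.1.2 = s.2.2) ∧
      meshTrace (δ : ℝ) π =
        ⋃ s ∈ S, segment ℝ (⟨(s.1.1 : ℝ), (s.1.2 : ℝ)⟩ : ℂ) ⟨(s.2.1 : ℝ), (s.2.2 : ℝ)⟩ := by
  induction π with
  | nil =>
    refine ⟨∅, by simp, ?_⟩
    simp [meshTrace, walkTrace_nil]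
  | @cons a b c h p ih =>
    obtain ⟨S, hS, hSeq⟩ := ih
    refine ⟨insert ((δ * a 0, δ * a 1), (δ * b 0, δ * b 1)) S, ?_, ?_⟩
    · intro s hs
      rw [Finset.mem_insert] at hs
      rcases hs with rfl | hs
      · obtain ⟨i, hi | hi⟩ := (zdGraph_adj_iff a b).1 h
        · fin_cases i
          · right; simp [hi]
          · left; simp [hi]
        · fin_cases i
          · right; simp [hi]
          · left; simp [hi]
      · exact hS s hs
    · have hcons : meshTrace (δ : ℝ) (SimpleGraph.Walk.cons h p) =
          segment ℝ (meshPoint (δ : ℝ) a) (meshPoint (δ : ℝ) b) ∪ meshTrace (δ : ℝ) p := by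
        simp only [meshTrace, walkTrace_cons, image_union, segment_meshPoint_eq_image]
      rw [hcons, Finset.set_biUnion_insert, hSeq]
      congr 1
      have ea : meshPoint (δ : ℝ) a = (⟨((δ * a 0 : ℚ) : ℝ), ((δ * a 1 : ℚ) : ℝ)⟩ : ℂ) :=
        Complex.ext (by simp) (by simp)
      have eb : meshPoint (δ : ℝ) b = (⟨((δ * b 0 : ℚ) : ℝ), ((δ * b 1 : ℚ) : ℝ)⟩ : ℂ) :=
        Complex.ext (by simp) (by simp)
      rw [ea, eb]

end Summit.CriticalPhenomena.CardyFormulaZ2.Cruxes.LagHandOff.HittingTournament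

end
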